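import Summits.BirchSwinnertonDyer.BirchSwinnertonDyer.Theorems.AdditiveKolyvaginRoadKolyvaginJumpStructures
import Summits.BirchSwinnertonDyer.BirchSwinnertonDyer.Theorems.AdditiveKolyvaginRoadKolyvaginTransverseCount
import Summits.BirchSwinnertonDyer.BirchSwinnertonDyer.Theorems.AdditiveKolyvaginRoadToricCount
import Summits.BirchSwinnertonDyer.BirchSwinnertonDyer.Theorems.AdditiveKolyvaginRoadToricDictionary
import Summits.BirchSwinnertonDyer.BirchSwinnertonDyer.Theorems.AdditiveKolyvaginRoadToricLagrangianIso
import HarnessLib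

/-!
# Route `AdditiveKolyvaginRoad`, crux `KolyvaginPrimitiveAdditive` (item stmt-BirchSwinnertonDyer-20132), stub LOC,
# towards (Supply) at a general prime `p` — the (J) binder `hjump` FROM THE POITOU–TATE FACT ALONE
# (p-generic port of §5 of koly3b's `…ZhangSupplyTransverseCount`, ordinary ↦ TORIC)
# (cell `pub/bsd-wall`, lead prover `bsd-wall-akr-p1` g4; `--supports stmt-BirchSwinnertonDyer-20132`, helper)

WHAT. `hjump_of_poitouTateP`: the binder `hjump` of the signed (Supply) at a general odd prime `p` — for every non-empty
Bertolini–Darmon admissible level `n`, Kolyvagin prime `ℓ ∉ T` and `x₀ ∈ H¹(K, E[p])`, a class of the relaxed level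
structure `G(n, ℓ, T)` (Kummer at `∞` and off `λ ∪ plK(T) ∪ {v ∣ n}`, TORIC above `n`, TRANSVERSE on `plK(T)`, free at
`λ = plK ℓ`) off the line `ℤ · loc_λ x₀` modulo `ker loc_λ` — from `IsImaginaryQuadratic K`, `p ≠ 2`, `d_K < −4`, the
places `plK` of the Kolyvagin primes and the named PT fact `poitouTate_selmerStructure_duality K`:
`hjump_of_localLagrangiansP` (akr-p1 g4) with `Ltor v := AdditiveKoly.toricLocalCondition` (clauses: akr-p1 g3
`htorIso_toricLocalCondition` p551130, g3 `mem_toricLocalKer_of_res_mem_toricLocalCondition` p550746, g4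
`natCard_galoisCohomology_one_le_mul_natCard_toricLocalCondition` p555624) and `Ltr (plK ℓ') :=
Method2.transverseLocalCondition … ℓ'` (clauses: g3 `htrIso_∕htrCard_∕htrIncl_transverseLocalCondition_P`,
p547854 ∕ p552441).

HONEST FRAMING: one theorem (+ the injectivity of `plK`); 0 definitions, 0 named facts, 0 `sorry`; CONDITIONAL on the
named PT fact; closes nothing.

References: [cite: WZhang2014, §8.1, Lemma 8.2] [cite: McCallumLMS1991, Prop. 2.1] [cite: BertoliniDarmon2005,
§2.2–§2.3] [cite: GrossLMS1991, §3–§4] [cite: MilneADT2006, Ch. I, Thm. 2.8, Thm. 4.10].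
-/

-- single-conjunct summit: `Summit.BirchSwinnertonDyer.BirchSwinnertonDyer.…` repeats the name by design
set_option linter.dupNamespace false

noncomputable section

open scoped Classical NumberField
open Function NumberField IsDedekindDomain Field WeierstrassCurve
open Literature.NumberTheory.EllipticCurves Literature.NumberTheory.EllipticCurves.ModularForms
open Literature.NumberTheory.GaloisRepresentations Literature.NumberTheory.GaloisRepresentations.DiscreteGaloisModule
  Literature.NumberTheory.GaloisCohomology
open Summit.BirchSwinnertonDyer.Rank1Residual.X11b Summit.BirchSwinnertonDyer.Rank1Residual.GaloisImage
open Summit.BirchSwinnertonDyer.Rank1Residual.X11b.Three.Koly.ZhangSupply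
open Summit.BirchSwinnertonDyer.Rank1Residual.X11b.Three.Koly.Method2

namespace Summit.BirchSwinnertonDyer.BirchSwinnertonDyer.Theorems.AdditiveKoly

variable (W : WeierstrassCurve ℚ) (K : Type) [Field K] [NumberField K] (p : ℕ) [W.IsElliptic] [W.IsGloballyMinimal]
  [Fact p.Prime] [∀ v : Place K, CompactSpace (absoluteGaloisGroup (Place.Completion v))]

omit [W.IsElliptic] [Fact p.Prime] [∀ v : Place K, CompactSpace (absoluteGaloisGroup (Place.Completion v))] in
/-- The places of the Kolyvagin primes are pairwise distinct (`hplK`). [folklore] -/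
theorem plK_injective_P
    (plK : {ℓ // Zhang2014.IsKolyvaginPrime (W.conductorNorm ℤ) W K p ℓ} → HeightOneSpectrum (𝓞 K))
    (hplK : ∀ ℓ, ((ℓ : ℕ) : 𝓞 K) ∈ (plK ℓ).asIdeal) : Function.Injective plK := by
  intro ℓ ℓ' h
  by_contra hne
  have hcop : Nat.Coprime (ℓ : ℕ) (ℓ' : ℕ) := (Nat.coprime_primes ℓ.2.1 ℓ'.2.1).mpr (fun h' ↦ hne (Subtype.ext h'))
  exact not_mem_asIdeal_of_coprime K hcop (plK ℓ) (hplK ℓ) (h ▸ hplK ℓ')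

/-- **The (J) binder `hjump` at a general odd prime, from the Poitou–Tate fact alone** — the TORIC-side clauses of
`hjump_of_localLagrangiansP` discharged by `AdditiveKoly.toricLocalCondition` (isotropy akr-p1 g2/g3, count g4,
dictionary g3) and the TRANSVERSE-side clauses by `Method2.transverseLocalCondition` (akr-p1 g3). Frame: `K` imaginary
quadratic with `d_K < −4` (`#Gal(K[ℓ]/K[1]) = ℓ + 1`), `p` odd. [cite: WZhang2014, Lemma 8.2] [cite: McCallumLMS1991,
Prop. 2.1] [cite: BertoliniDarmon2005, §2.2–§2.3] [cite: MilneADT2006, Ch. I, Thm. 4.10] -/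
theorem hjump_of_poitouTateP (hK : IsImaginaryQuadratic K) (hp2 : p ≠ 2) (hd : NumberField.discr K < -4)
    (hPT : poitouTate_selmerStructure_duality K) (ι : K →+* ℂ)
    (plK : {ℓ // Zhang2014.IsKolyvaginPrime (W.conductorNorm ℤ) W K p ℓ} → HeightOneSpectrum (𝓞 K))
    (hplK : ∀ ℓ, ((ℓ : ℕ) : 𝓞 K) ∈ (plK ℓ).asIdeal) :
    ∀ (n : Finset (AdmQ W K p)), n.Nonempty →
      ∀ (ℓ : {ℓ // Zhang2014.IsKolyvaginPrime (W.conductorNorm ℤ) W K p ℓ}) (T : Finset _), ℓ ∉ T →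
      ∀ x₀ : Vp W K p, ∃ x : Vp W K p,
        ((∀ w : InfinitePlace K, x ∈ selmerLocalKer (W.baseChange K) w.Completion ((p ^ 1 : ℕ) : ℤ)) ∧
          (∀ v : HeightOneSpectrum (𝓞 K), v ≠ plK ℓ → (∀ ℓ' ∈ T, plK ℓ' ≠ v) →
            ((∀ q ∈ n, ((q : ℕ) : 𝓞 K) ∉ v.asIdeal) →
              x ∈ selmerLocalKer (W.baseChange K) (v.adicCompletion K) ((p ^ 1 : ℕ) : ℤ)) ∧
            (∀ q ∈ n, ((q : ℕ) : 𝓞 K) ∈ v.asIdeal →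
              x ∈ toricLocalKer (W.baseChange K) (v.adicCompletion K) ((p ^ 1 : ℕ) : ℤ))) ∧
          (∀ ℓ' ∈ T, x ∈ transverseLocalKerP W K p ι ℓ' (plK ℓ'))) ∧
        ∀ a : ℤ, x - a • x₀ ∉ (W.baseChange K).torsionLocalKer ((plK ℓ).adicCompletion K) ((p ^ 1 : ℕ) : ℤ) := by
  have hp : p.Prime := Fact.out
  haveI : NeZero (p ^ 1 : ℕ) := ⟨pow_ne_zero 1 hp.ne_zero⟩
  haveI : Finite (geomTorsion (W.baseChange K) ((p ^ 1 : ℕ) : ℤ)) := finite_geomTorsion_of_neZero (W.baseChange K) (p ^ 1)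
  have hK2 : Module.finrank ℚ K = 2 := hK.1
  have hinj := plK_injective_P W K p plK hplK
  -- the two families of genuine local conditions
  let Ltor : (v : HeightOneSpectrum (𝓞 K)) →
      AddSubgroup (galoisCohomology (((W.baseChange K).torsionGaloisModule ((p ^ 1 : ℕ) : ℤ)).toLocal (Sum.inr v)) 1) :=
    fun v ↦ toricLocalCondition (W.baseChange K) (v.adicCompletion K) ((p ^ 1 : ℕ) : ℤ)
  let Ltr : (v : HeightOneSpectrum (𝓞 K)) →
      AddSubgroup (galoisCohomology (((W.baseChange K).torsionGaloisModule ((p ^ 1 : ℕ) : ℤ)).toLocal (Sum.inr v)) 1) :=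
    fun v ↦ if h : ∃ ℓ', plK ℓ' = v then
      transverseLocalCondition (W.baseChange K) ι (Classical.choose h).1 (v.adicCompletion K) ((p ^ 1 : ℕ) : ℤ) else ⊥
  have hLtr : ∀ ℓ', Ltr (plK ℓ') = transverseLocalCondition (W.baseChange K) ι ℓ'.1 ((plK ℓ').adicCompletion K)
      ((p ^ 1 : ℕ) : ℤ) := by
    intro ℓ'
    have h : ∃ ℓ'', plK ℓ'' = plK ℓ' := ⟨ℓ', rfl⟩
    have hc : Classical.choose h = ℓ' := hinj (Classical.choose_spec h)
    simp only [Ltr, dif_pos h]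
    rw [hc]
  refine hjump_of_localLagrangiansP W K p ι hK hPT plK hplK Ltor Ltr
    (fun q v hqv e hμ hadd₁ hadd₂ halt _ hgal ↦ htorIso_toricLocalCondition W K p hK2 q v hqv e hμ hadd₁ hadd₂ halt hgal)
    (fun q v hqv ↦ natCard_galoisCohomology_one_le_mul_natCard_toricLocalCondition W K p hK2 q v hqv)
    (fun q v _ x hx ↦
      mem_toricLocalKer_of_res_mem_toricLocalCondition (W.baseChange K) (p ^ 1) (v.adicCompletion K) hx)
    (fun ℓ' e hμ hadd₁ hadd₂ _ _ hgal a ha b hb ↦ ?_) (fun ℓ' ↦ ?_) (fun ℓ' x hx ↦ ?_)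
  · rw [hLtr] at ha hb
    exact htrIso_transverseLocalCondition_P W K p hK hp2 hd ι ℓ'.2 (plK ℓ') (hplK ℓ') e hμ hadd₁ hadd₂ hgal a ha b hb
  · rw [hLtr]
    exact (htrCard_transverseLocalCondition_P W K p hK hp2 hd ι ℓ'.2 (plK ℓ') (hplK ℓ')).symm.le
  · rw [hLtr] at hx
    exact htrIncl_transverseLocalCondition_P W K p hK ι ℓ'.2 (plK ℓ') (hplK ℓ') x hx

end Summit.BirchSwinnertonDyer.BirchSwinnertonDyer.Theorems.AdditiveKoly

end
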